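import Summits.AtomisticToContinuum.HydrodynamicLimit.Theorems.OneFlightGossipEngineClampedCurrentsDockHeartWindow
import Summits.AtomisticToContinuum.HydrodynamicLimit.Theorems.OneFlightGossipEngineClampedCurrentsDockHeartPrelims
import Summits.AtomisticToContinuum.HydrodynamicLimit.Theorems.OneFlightGossipEngineClampedCurrentsDockKineticInstance
import Summits.AtomisticToContinuum.HydrodynamicLimit.Theorems.OneFlightGossipEngineClampedCurrentsDockLocalInstance
import Summits.AtomisticToContinuum.HydrodynamicLimit.Theorems.OneFlightGossipEngineClampedCurrentsDockCubicChannel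
import Summits.AtomisticToContinuum.HydrodynamicLimit.Theorems.OneFlightGossipEngineClampedCurrentsDockCubicPathwise
import Summits.AtomisticToContinuum.HydrodynamicLimit.Theorems.OneFlightGossipEngineClampedCurrentsDockCutoffFamily
import Summits.AtomisticToContinuum.HydrodynamicLimit.Theorems.OneFlightGossipEngineClampedCurrentsDockTransferTails
import Summits.AtomisticToContinuum.HydrodynamicLimit.Theorems.OneFlightGossipEngineClampedCurrentsDockFlowShiftFreeze
import Summits.AtomisticToContinuum.HydrodynamicLimit.Theorems.OneFlightGossipEngineClampedCurrentsDockWindowBalance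
import Summits.AtomisticToContinuum.HydrodynamicLimit.Theorems.OneFlightGossipEngineClampedCurrentsDockStaticLimit
import Summits.AtomisticToContinuum.HydrodynamicLimit.Theorems.ImplosionDichotomyHydroLimitInBandOfHeart
import Summits.AtomisticToContinuum.HydrodynamicLimit.Theorems.ImplosionDichotomyHydroLimitInBandLedgerApriori
import Summits.AtomisticToContinuum.HydrodynamicLimit.Theorems.TwoClocksClampedWindowDockActivityInversion
import Summits.AtomisticToContinuum.HydrodynamicLimit.Theorems.DenseExcursion.Negative.Everywhere
import HarnessLib

/-!
# The window clause of the heart `OneWindowLedger` — Yau's one-window entropy ledger, quantifier plumbing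
# (stub `stub_windowClause`, line `IdeatorOneSketch`, crux `HydroLimitInBand`, stmt-AtomisticToContinuum-9133; skeleton v11)

Support file (`--supports stmt-AtomisticToContinuum-9133`); defs re-declared verbatim from `Cruxes/HydroLimitInBand/Lines/IdeatorOneSketch.lean`
v11, the ten antecedents resolving to the landed Theorems copies as in `…HydroLimitInBandOfHeart`. THE LAST FILE OF THE SHARED HEART: all the
analysis is the sibling crux 14680's lead's (line IdeatorTwoSketch), landed under `Theorems/OneFlightGossipEngineClampedCurrentsDock*.lean`
(`ClampedCurrentsDockHeart.window_estimate` = C0 + S8 + FZ + FS + CC1 + ES×5 + QC-b + CC3 + TM at fixed level; KC1, LC1, QC-b, CC3, C0, E8);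
their final assembly was in the gate queue when 14680 was retired by the route repair of 2026-08-16T20:36Z and never landed. This file redoes
that assembly — QUANTIFIER PLUMBING ONLY: thresholds `ηw` (EOS window, KC1/LC1 guards, statics, activity inversion), `σ₀` (QC-b, CC3, ECT,
1/2), `K = 5/β`, `β = min(β₀^{KC1}, β₀^{LC1})` fixed after `(t, V, K⋆)` and before `ε`, then `ε ↦ (ε′, ε₁, ε₃, τ, N₀)`, and per window C0 +
`window_estimate` + S7a for the running supremum. Lead c3 of crux 9133 (prover-line-stmt-AtomisticToContinuum-9133-c3-0), cycle 4.
-/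

noncomputable section

open MeasureTheory Filter Set Topology InformationTheory
open scoped ENNReal

namespace Summit.AtomisticToContinuum.HydrodynamicLimit.Theorems.HydroLimitInBandHeart

open Literature.MathematicalPhysics.KineticTheory Literature.Analysis.FluidPDE Literature.Analysis.FunctionSpaces
open Summit.AtomisticToContinuum.HydrodynamicLimit.Theses
open Summit.AtomisticToContinuum.HydrodynamicLimit.Theorems
open Summit.AtomisticToContinuum.HydrodynamicLimit.Theorems.ClampedCurrentsDockPathwise (PathwiseEntropyProduction)
open Summit.AtomisticToContinuum.HydrodynamicLimit.Theorems.ClampedCurrentsDockCancellation (EulerCancellation)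
open Summit.AtomisticToContinuum.HydrodynamicLimit.Theorems.ClampedCurrentsDockEos (EosConsistency)
open Summit.AtomisticToContinuum.HydrodynamicLimit.Theorems.ClampedCurrentsDockClampRemainder (TransferClampRemainder)
open Summit.AtomisticToContinuum.HydrodynamicLimit.Theorems.HydroLimitInBandOfHeart
  (LocalClampedTransferWindowLDFamily CollisionEnergyActivityTails CoherentSuprathermalContentVanishesW KineticCurrentsWindowLDFamily)

/-- registered stub signature (window clause, in band) of line IdeatorOneSketch, crux HydroLimitInBand (stmt-9133) — route-internal
proposition in the vocabulary of the crux, not a cited fact -/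
def WindowClauseInBand : Prop :=
  ∀ (r : ℝ) (Rf : ℝ → ℝ), 0 < r →
    (∃ p : FormalMultilinearSeries ℝ ℝ ℝ, HasFPowerSeriesOnBall Rf p 0 (ENNReal.ofReal r)) →
    (∃ L : NNReal, LipschitzOnWith L Rf (Icc 0 r)) →
    (∀ x ∈ Ioo (-r) r, 0 < Rf x ∧ Rf x * (∑' j : ℕ, bE j / (j.factorial : ℝ) * (x * Rf x) ^ j) = 1) →
    (∀ x ∈ Icc 0 r, 1 ≤ Rf x ∧ Rf x ≤ 2) → ContinuousOn Rf (Icc 0 r) →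
    (∀ x ∈ Ioo (-r) r, ∀ R ∈ Icc (1 / 2 : ℝ) 2,
      R * (∑' j : ℕ, bE j / (j.factorial : ℝ) * (x * R) ^ j) = 1 → R = Rf x) →
    ∀ η₀ : ℝ, 0 < η₀ →
    (∀ (a θ₀ : T3 → ℝ) (u₀ : T3 → V3), Continuous a → Continuous θ₀ → Continuous u₀ → (∀ x, 0 < a x) →
      (∀ x, 0 < θ₀ x) → ∀ σ : ℝ, 0 < σ → σ ^ 3 * (⨆ x, a x) ≤ η₀ * ∫ x, a x →
      ∃ ρ₀ : T3 → ℝ, Continuous ρ₀ ∧ (∀ x, 0 < ρ₀ x) ∧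
        (∀ (N : ℕ) (Φ : HardSphereFlow (Torus.geometry (Fin 3)) (hsDiameter σ N) (N + 1)),
          IsProbabilityMeasure (localGibbsLaw σ a u₀ θ₀ N Φ)) ∧
        ∀ χ : T3 → ℝ, Continuous χ → ∀ δ : ℝ, 0 < δ → ∃ C : ℝ, 0 < C ∧
          ∀ (N : ℕ) (Φ : HardSphereFlow (Torus.geometry (Fin 3)) (hsDiameter σ N) (N + 1)),
            localGibbsLaw σ a u₀ θ₀ N Φ {z | δ < |empiricalDensityField z χ - ∫ x, χ x * ρ₀ x|} ≤
                ENNReal.ofReal (C * Real.exp (-(C⁻¹ * ((N : ℝ) + 1)))) ∧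
              localGibbsLaw σ a u₀ θ₀ N Φ
                  {z | δ < ‖empiricalMomentumField z χ - ∫ x, (χ x * ρ₀ x) • u₀ x‖} ≤
                ENNReal.ofReal (C * Real.exp (-(C⁻¹ * ((N : ℝ) + 1)))) ∧
              localGibbsLaw σ a u₀ θ₀ N Φ {z | δ < |empiricalEnergyField z χ -
                  ∫ x, χ x * totalEnergyDensity (ρ₀ x) (u₀ x) (θ₀ x)|} ≤
                ENNReal.ofReal (C * Real.exp (-(C⁻¹ * ((N : ℝ) + 1))))) →
    ∃ ηw : ℝ, 0 < ηw ∧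
    ∀ (a₀ θ₀ : T3 → ℝ) (u₀ : T3 → V3), Continuous a₀ → Continuous θ₀ → Continuous u₀ →
      (∀ x, 0 < a₀ x) → (∀ x, 0 < θ₀ x) →
      ∃ σ₀ : ℝ, 0 < σ₀ ∧ ∀ σ : ℝ, 0 < σ → σ < σ₀ →
        ∀ (T : ℝ) (ρ θ : ℝ → T3 → ℝ) (u : ℝ → T3 → V3), IsHardSphereEulerSolution σ T ρ u θ →
          (∀ s ∈ Set.Ico 0 T, ∀ x, ρ s x * σ ^ 3 < ηw) →
          ∀ Φ : (N : ℕ) → HardSphereFlow (Torus.geometry (Fin 3)) (hsDiameter σ N) (N + 1),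
            TendstoHydroFieldsAt (fun N => localGibbsLaw σ a₀ u₀ θ₀ N (Φ N)) Φ ρ u θ 0 →
            ∀ t ∈ Set.Ioo 0 T,
              ∃ K : ℝ, 0 ≤ K ∧
                ∀ ε : ℝ, 0 < ε → ∃ τ : ℝ, 0 < τ ∧ ∃ N₀ : ℕ, ∀ N : ℕ, N₀ ≤ N →
                ∀ s : ℝ, 0 ≤ s → s + τ * ((N : ℝ) + 1) ^ (-(1 / 3 : ℝ)) ≤ t →
                (klDiv ((Φ N).lawAt (localGibbsLaw σ a₀ u₀ θ₀ N (Φ N)) (s + τ * ((N : ℝ) + 1) ^ (-(1 / 3 : ℝ))))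
                  (localGibbsLaw σ (fun x => ρ (s + τ * ((N : ℝ) + 1) ^ (-(1 / 3 : ℝ))) x *
                      Rf (σ ^ 3 * ρ (s + τ * ((N : ℝ) + 1) ^ (-(1 / 3 : ℝ))) x))
                    (u (s + τ * ((N : ℝ) + 1) ^ (-(1 / 3 : ℝ)))) (θ (s + τ * ((N : ℝ) + 1) ^ (-(1 / 3 : ℝ))))
                    N (Φ N))).toReal ≤
                (klDiv ((Φ N).lawAt (localGibbsLaw σ a₀ u₀ θ₀ N (Φ N)) s)
                  (localGibbsLaw σ (fun x => ρ s x * Rf (σ ^ 3 * ρ s x)) (u s) (θ s) N (Φ N))).toReal +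
                K * (τ * ((N : ℝ) + 1) ^ (-(1 / 3 : ℝ))) *
                  sSup ((fun s' => (klDiv ((Φ N).lawAt (localGibbsLaw σ a₀ u₀ θ₀ N (Φ N)) s')
                    (localGibbsLaw σ (fun x => ρ s' x * Rf (σ ^ 3 * ρ s' x)) (u s') (θ s') N (Φ N))).toReal) ''
                    Set.Icc 0 (s + τ * ((N : ℝ) + 1) ^ (-(1 / 3 : ℝ)))) +
                (τ * ((N : ℝ) + 1) ^ (-(1 / 3 : ℝ))) * ((N : ℝ) + 1) * ε +
                ((Real.log (posPartition (fun x => ρ (s + τ * ((N : ℝ) + 1) ^ (-(1 / 3 : ℝ))) x *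
                      Rf (σ ^ 3 * ρ (s + τ * ((N : ℝ) + 1) ^ (-(1 / 3 : ℝ))) x)) (hsDiameter σ N) (N + 1)) -
                    Real.log (posPartition (fun x => ρ s x * Rf (σ ^ 3 * ρ s x)) (hsDiameter σ N) (N + 1))) +
                  (τ * ((N : ℝ) + 1) ^ (-(1 / 3 : ℝ))) * ((N : ℝ) + 1) *
                    (∫ x, ρ s x * (ρ s x * σ ^ 3) * deriv hsCompressibility (ρ s x * σ ^ 3) *
                      Torus.divergence (u s) x))

/-- registered stub signature `stub_windowClause` of line IdeatorOneSketch, crux HydroLimitInBand (stmt-9133): the window clause from the ten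
antecedents of the shared heart `OneWindowLedger` — route-internal, not a cited fact -/
def WindowClause : Prop :=
  PathwiseEntropyProduction → EulerCancellation → EosConsistency → TransferClampRemainder →
    LocalClampedTransferWindowLDFamily → CollisionEnergyActivityTails →
    CoherentSuprathermalContentVanishesW → KineticCurrentsWindowLDFamily → OneFlightGossipEngine.CollisionActivityTails →
    OneFlightGossipEngine.EnergyCurrentTails → WindowClauseInBand

/-- `A (N+1)^{-1/3} ≤ ε` for `N` large. [folklore] -/
theorem exists_nat_mul_rpow_le {A ε : ℝ} (hε : 0 < ε) :
    ∃ N₀ : ℕ, ∀ N : ℕ, N₀ ≤ N → A * ((N : ℝ) + 1) ^ (-(1 / 3 : ℝ)) ≤ ε := by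
  have h1 : Tendsto (fun N : ℕ => ((N : ℝ) + 1)) atTop atTop :=
    tendsto_atTop_add_const_right _ 1 tendsto_natCast_atTop_atTop
  have h2 : Tendsto (fun N : ℕ => ((N : ℝ) + 1) ^ (-(1 / 3 : ℝ))) atTop (𝓝 0) :=
    (tendsto_rpow_neg_atTop (by norm_num : (0 : ℝ) < 1 / 3)).comp h1
  have h3 : Tendsto (fun N : ℕ => A * ((N : ℝ) + 1) ^ (-(1 / 3 : ℝ))) atTop (𝓝 0) := by
    simpa using h2.const_mul A
  obtain ⟨N₀, hN₀⟩ := Filter.eventually_atTop.1 (h3.eventually (Iic_mem_nhds hε))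
  exact ⟨N₀, fun N hN => hN₀ N hN⟩

/-- **The packing guard of the reference-law inputs along a solution in band.** For a continuous density `ρ > 0` of unit mass with
`ρ σ³ < η` pointwise and an insertion factor `1 ≤ Rf ≤ 2` on `[0, r]`, `η ≤ r`, the explicit activity `a = ρ Rf(σ³ρ)` satisfies
`σ³ sup a ≤ ηX ∫ a` as soon as `2 η ≤ ηX`. [folklore] -/
theorem guard_of_band {r η ηX σ : ℝ} {Rf : ℝ → ℝ} {ρ : T3 → ℝ} (hbd : ∀ x ∈ Icc 0 r, 1 ≤ Rf x ∧ Rf x ≤ 2) (hηr : η ≤ r)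
    (hηX : 2 * η ≤ ηX) (hσ : 0 < σ) (hρc : Continuous ρ) (hρ0 : ∀ x, 0 < ρ x) (hρ1 : ∫ x, ρ x = 1)
    (hpack : ∀ x, ρ x * σ ^ 3 < η) (hac : Continuous fun x => ρ x * Rf (σ ^ 3 * ρ x)) :
    σ ^ 3 * (⨆ x, ρ x * Rf (σ ^ 3 * ρ x)) ≤ ηX * ∫ x, ρ x * Rf (σ ^ 3 * ρ x) := by
  have hσ3 : 0 < σ ^ 3 := pow_pos hσ 3
  have hRf : ∀ x, 1 ≤ Rf (σ ^ 3 * ρ x) ∧ Rf (σ ^ 3 * ρ x) ≤ 2 := fun x =>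
    hbd _ ⟨mul_nonneg hσ3.le (hρ0 x).le, by nlinarith [hpack x, (hρ0 x).le]⟩
  have hint : 1 ≤ ∫ x, ρ x * Rf (σ ^ 3 * ρ x) := by
    have hle : ∫ x, ρ x ≤ ∫ x, ρ x * Rf (σ ^ 3 * ρ x) := by
      refine integral_mono (hρc.integrable_of_hasCompactSupport (HasCompactSupport.of_compactSpace _))
        (hac.integrable_of_hasCompactSupport (HasCompactSupport.of_compactSpace _)) fun x => ?_
      have := (hRf x).1
      have h0 := (hρ0 x).le
      show ρ x ≤ ρ x * Rf (σ ^ 3 * ρ x)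
      nlinarith
    linarith
  have hsup : (⨆ x, ρ x * Rf (σ ^ 3 * ρ x)) ≤ 2 * η / σ ^ 3 := by
    refine ciSup_le fun x => ?_
    rw [le_div_iff₀ hσ3]
    have h1 := (hRf x).2
    have h2 := hpack x
    have h0 : 0 ≤ ρ x * σ ^ 3 := mul_nonneg (hρ0 x).le hσ3.le
    calc ρ x * Rf (σ ^ 3 * ρ x) * σ ^ 3 = (ρ x * σ ^ 3) * Rf (σ ^ 3 * ρ x) := by ring
      _ ≤ (ρ x * σ ^ 3) * 2 := mul_le_mul_of_nonneg_left h1 h0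
      _ ≤ 2 * η := by linarith
  have hη0 : 0 ≤ η := by
    have := hpack 0
    have h0 : 0 ≤ ρ 0 * σ ^ 3 := mul_nonneg (hρ0 0).le hσ3.le
    linarith
  calc σ ^ 3 * (⨆ x, ρ x * Rf (σ ^ 3 * ρ x)) ≤ σ ^ 3 * (2 * η / σ ^ 3) := by gcongr
    _ = 2 * η := by field_simp
    _ ≤ ηX * 1 := by linarith
    _ ≤ ηX * ∫ x, ρ x * Rf (σ ^ 3 * ρ x) := by
        have hX0 : 0 ≤ ηX := by linarith
        exact mul_le_mul_of_nonneg_left hint hX0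

/-- **The window clause of Yau's one-window entropy ledger, in band** (registered stub `stub_windowClause` of stmt-9133).
[cite: Yau1991, §2; OllaVaradhanYau1993, §3] -/
theorem stub_windowClause : WindowClause := by
  intro _hS2 _hS8 _hS4 _hS10 hLC hCEAT hCSCV hKC hCAT hECT r Rf hr hana hLip hsol hbd hcont huniq η₀ hη₀ _HU
  obtain ⟨η₁, hη₁, hη₁r, F, hF, hZF, hRfF⟩ := ClampedCurrentsDockHeart.eosBridge hr hsol hbd hcont huniq
  obtain ⟨ηK, hηK, HK⟩ := ClampedCurrentsDockKineticInstance.stub_kineticInstance hKC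
    ClampedCurrentsDockCutoffFamily.stub_loHeatFluxCutoffFamily
  obtain ⟨ηC, hηC, HC⟩ := ClampedCurrentsDockLocalInstance.stub_localCollisionalInstance hLC
  obtain ⟨ηs, hηs, HS⟩ := ClampedCurrentsDockStaticLimit.stub_staticLimit r Rf hr hana hLip hsol hbd hcont huniq
  set ηA : ℝ := min (r / (2 * (2 * (2 * Real.exp 1 + 1)))) (1 / (64 * Real.exp 1 * v₁)) with hηA
  have hηA0 : 0 < ηA := by
    have := v₁_pos
    have := Real.exp_pos 1
    positivity
  set ηw : ℝ := min (min (η₁ / 2) (min (ηK / 2) (ηC / 2))) (min ηs ηA) with hηw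
  have hηw0 : 0 < ηw := by positivity
  have hηw1 : ηw ≤ η₁ / 2 := (min_le_left _ _).trans (min_le_left _ _)
  have hηwK : ηw ≤ ηK / 2 := (min_le_left _ _).trans ((min_le_right _ _).trans (min_le_left _ _))
  have hηwC : ηw ≤ ηC / 2 := (min_le_left _ _).trans ((min_le_right _ _).trans (min_le_right _ _))
  have hηws : ηw ≤ ηs := (min_le_right _ _).trans (min_le_left _ _)
  have hηwA : ηw ≤ ηA := (min_le_right _ _).trans (min_le_right _ _)
  have hηwr : ηw ≤ r := by
    have : ηA ≤ r / (2 * (2 * (2 * Real.exp 1 + 1))) := min_le_left _ _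
    have h2 : r / (2 * (2 * (2 * Real.exp 1 + 1))) ≤ r := by
      rw [div_le_iff₀ (by positivity)]
      have := Real.exp_pos 1
      nlinarith
    linarith
  refine ⟨ηw, hηw0, fun a₀ θ₀ u₀ ha hθ hu ha0 hθ0 => ?_⟩
  obtain ⟨σQ, hσQ, HQ⟩ := ClampedCurrentsDockCubicChannel.stub_cubicChannel
    ClampedCurrentsDockCubicPathwise.stub_cubicChannelPathwise ClampedCurrentsDockThirdMoment.stub_thirdMomentWindow
    ClampedCurrentsDockFlowShiftFreeze.windowFlowShift hCSCV hECT a₀ θ₀ u₀ ha hθ hu ha0 hθ0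
  obtain ⟨σT, hσT, HT⟩ := ClampedCurrentsDockTransferTails.stub_transferActivityTails hCAT hCEAT a₀ θ₀ u₀ ha hθ hu ha0 hθ0
  obtain ⟨σE, hσE, HE⟩ := hECT a₀ θ₀ u₀ ha hθ hu ha0 hθ0
  refine ⟨min (min σQ σT) (min σE (1 / 2)), lt_min (lt_min hσQ hσT) (lt_min hσE (by norm_num)),
    fun σ hσ hσlt T ρ θ u hE hguard Φ htie t ht => ?_⟩
  have hσQ' : σ < σQ := hσlt.trans_le ((min_le_left _ _).trans (min_le_left _ _))
  have hσT' : σ < σT := hσlt.trans_le ((min_le_left _ _).trans (min_le_right _ _))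
  have hσE' : σ < σE := hσlt.trans_le ((min_le_right _ _).trans (min_le_left _ _))
  have hσ2 : σ < 1 / 2 := hσlt.trans_le ((min_le_right _ _).trans (min_le_right _ _))
  have hσ3 : 0 < σ ^ 3 := pow_pos hσ 3
  have hT : 0 < T := ht.1.trans ht.2
  have htI : t ∈ Ico 0 T := ⟨ht.1.le, ht.2⟩
  have hIt : Icc 0 t ⊆ Ico 0 T := fun s hs => ⟨hs.1, hs.2.trans_lt ht.2⟩
  have hmass : ∀ s ∈ Ico 0 T, ∫ x, ρ s x = 1 := fun s hs =>
    (DenseExcursionEverywhere.integral_density_eq hE hs).trans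
      (DenseExcursionEverywhere.integral_density_zero_eq_one hσ2.le ha hθ hu ha0 hθ0 Φ htie)
  have hgs : ∀ s ∈ Ico 0 T, ∀ x, ρ s x * σ ^ 3 < ηs := fun s hs x => (hguard s hs x).trans_le hηws
  have hg1 : ∀ s ∈ Ico 0 T, ∀ x, ρ s x * σ ^ 3 ∈ Ioo 0 η₁ := fun s hs x =>
    ⟨mul_pos (hE.density_pos s hs x) hσ3, (hguard s hs x).trans_le (hηw1.trans (by linarith))⟩
  have hg12 : ∀ s ∈ Icc 0 t, ∀ x, ρ s x * σ ^ 3 < η₁ / 2 := fun s hs x => (hguard s (hIt hs) x).trans_le hηw1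
  have hgr : ∀ s ∈ Icc 0 t, ∀ x, ρ s x * σ ^ 3 < r := fun s hs x => (hguard s (hIt hs) x).trans_le hηwr
  -- the explicit reference family: smooth and positive on `[0,T)` (SC-b)
  obtain ⟨hasm, hapos, -, -, -, -⟩ := HS σ hσ hσ2 T ρ θ u hE hgs hmass Φ t ht
  have hasm' : Torus.IsSmoothSpaceTimeOn (Ico 0 T) (fun s x => ρ s x * Rf (σ ^ 3 * ρ s x)) := hasm
  have hapos' : ∀ s ∈ Ico 0 T, ∀ x, 0 < (fun s x => ρ s x * Rf (σ ^ 3 * ρ s x)) s x := hapos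
  have hac : ∀ s ∈ Ico 0 T, Continuous fun x => ρ s x * Rf (σ ^ 3 * ρ s x) := fun s hs =>
    (hasm'.isSmooth_slice hs).continuous
  have hρc : ∀ s ∈ Ico 0 T, Continuous (ρ s) := fun s hs => (hE.smooth_density.isSmooth_slice hs).continuous
  -- the guards of KC1 / LC1 along the family
  have hguardX : ∀ {ηX : ℝ}, 2 * ηw ≤ ηX → ∀ s ∈ Icc 0 t,
      σ ^ 3 * (⨆ x, ρ s x * Rf (σ ^ 3 * ρ s x)) ≤ ηX * ∫ x, ρ s x * Rf (σ ^ 3 * ρ s x) :=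
    fun hX s hs => guard_of_band hbd hηwr hX hσ (hρc s (hIt hs)) (hE.density_pos s (hIt hs)) (hmass s (hIt hs))
      (hguard s (hIt hs)) (hac s (hIt hs))
  have hguardK : ∀ s ∈ Icc 0 t, σ ^ 3 * (⨆ x, (fun s x => ρ s x * Rf (σ ^ 3 * ρ s x)) s x) ≤
      ηK * ∫ x, (fun s x => ρ s x * Rf (σ ^ 3 * ρ s x)) s x := hguardX (by linarith)
  have hguardC : ∀ s ∈ Icc 0 t, σ ^ 3 * (⨆ x, ρ s x * Rf (σ ^ 3 * ρ s x)) ≤ ηC * ∫ x, ρ s x * Rf (σ ^ 3 * ρ s x) :=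
    hguardX (by linarith)
  -- the cubic channel: the suprathermal level `K⋆`
  obtain ⟨Kstar, hKstar, HQK⟩ := HQ σ hσ hσQ' T ρ θ u hE Φ htie t htI
  -- KC1 along the solution on the slab `[0,t]`
  have hθsmI : Torus.IsSmoothSpaceTimeOn (Icc 0 t) θ := hE.smooth_temperature.mono hIt
  have husmI : Torus.IsSmoothSpaceTimeOn (Icc 0 t) u := hE.smooth_velocity.mono hIt
  have haconI : ContinuousOn (Function.uncurry fun s x => ρ s x * Rf (σ ^ 3 * ρ s x)) (Icc 0 t ×ˢ univ) :=
    (ClampedCurrentsDockHeart.continuousOn_uncurry_of_isSmoothSpaceTimeOn hasm').mono (prod_mono hIt subset_rfl)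
  obtain ⟨G, hGc, ⟨CG, hCG⟩, hGagree, β₀K, hβ₀K, HKβ⟩ := HK t (fun s x => ρ s x * Rf (σ ^ 3 * ρ s x)) θ u ht.1.le haconI
    (fun s hs => hapos' s (hIt hs)) hθsmI husmI (fun s hs => hE.temperature_pos s (hIt hs)) σ hσ hguardK Φ Kstar hKstar
  set CG' : ℝ := max CG 0 with hCG'
  have hCG'0 : 0 ≤ CG' := le_max_right _ _
  have hCG'b : ∀ s ∈ Icc 0 t, ∀ y : T3 × ℝ, 0 ≤ y.2 → |G s y| ≤ CG' := fun s hs y hy => (hCG s hs y hy).trans (le_max_left _ _)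
  -- LC1 along the CLAMPED families (globally continuous), read on the slab
  set cl : ℝ → ℝ := ClampedCurrentsDockHeart.clampTime t with hcl_def
  have hclm : ∀ s, cl s ∈ Icc 0 t := fun s => ClampedCurrentsDockHeart.clampTime_mem ht.1.le s
  have hclI : ∀ s, cl s ∈ Ico 0 T := fun s => hIt (hclm s)
  set ac : ℝ → T3 → ℝ := fun s x => ρ (cl s) x * Rf (σ ^ 3 * ρ (cl s) x) with hac_def
  set θc : ℝ → T3 → ℝ := fun s => θ (cl s) with hθc_def
  set uc : ℝ → T3 → V3 := fun s => u (cl s) with huc_def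
  have hacc : ∀ s, Continuous (ac s) := fun s => hac _ (hclI s)
  have hac0 : ∀ s x, 0 < ac s x := fun s x => hapos' _ (hclI s) x
  have hθc0 : ∀ s x, 0 < θc s x := fun s x => hE.temperature_pos _ (hclI s) x
  have hacu : Continuous (Function.uncurry ac) := ClampedCurrentsDockHeart.continuous_uncurry_clamp ht.1.le haconI
  have hθcu : Continuous (Function.uncurry θc) :=
    ClampedCurrentsDockHeart.continuous_uncurry_clamp ht.1.le
      ((ClampedCurrentsDockHeart.continuousOn_uncurry_of_isSmoothSpaceTimeOn hE.smooth_temperature).mono (prod_mono hIt subset_rfl))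
  have hucu : Continuous (Function.uncurry uc) :=
    ClampedCurrentsDockHeart.continuous_uncurry_clamp ht.1.le
      ((ClampedCurrentsDockHeart.continuousOn_uncurry_of_isSmoothSpaceTimeOn hE.smooth_velocity).mono (prod_mono hIt subset_rfl))
  have hcl_id : ∀ s ∈ Icc 0 t, cl s = s := fun s hs => ClampedCurrentsDockHeart.clampTime_of_mem hs
  have hθcsm : Torus.IsSmoothSpaceTimeOn (Icc 0 t) θc :=
    ClampedCurrentsDockHeart.isSmoothSpaceTimeOn_congr hθsmI fun s hs => by simp only [hθc_def, hcl_id s hs]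
  have hucsm : Torus.IsSmoothSpaceTimeOn (Icc 0 t) uc :=
    ClampedCurrentsDockHeart.isSmoothSpaceTimeOn_congr husmI fun s hs => by simp only [huc_def, hcl_id s hs]
  have hguardCc : ∀ s ∈ Icc 0 t, σ ^ 3 * (⨆ x, ac s x) ≤ ηC * ∫ x, ac s x := fun s hs => by
    simp only [hac_def, hcl_id s hs]
    exact hguardC s hs
  obtain ⟨V₀C, _hV₀C, HCV⟩ := HC t ac θc uc hacc hacu hθcu hucu hac0 hθc0 hθcsm hucsm σ hσ hσ2 hguardCc Φ
  -- CC3: transfer-activity tails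
  obtain ⟨V₀T, hV₀T, HTV⟩ := HT σ hσ hσT' T ρ θ u hE Φ htie t htI
  set V : ℝ := max V₀C V₀T with hV
  have hV0 : 0 ≤ V := hV₀T.le.trans (le_max_right _ _)
  obtain ⟨β₀C, hβ₀C, HCβ⟩ := HCV V (le_max_left _ _)
  -- the tilt, fixed before `ε`
  set β : ℝ := min β₀K β₀C with hβ
  have hβ0 : 0 < β := lt_min hβ₀K hβ₀C
  have hβK : |(-β)| ≤ β₀K := by rw [abs_neg, abs_of_pos hβ0]; exact min_le_left _ _
  have hβC : |(-β)| ≤ β₀C := by rw [abs_neg, abs_of_pos hβ0]; exact min_le_right _ _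
  -- FZ: the freeze constant (also the common Lipschitz constant of the test functions)
  obtain ⟨Cfz, hCfz0, HFZ⟩ := ClampedCurrentsDockFlowShiftFreeze.freezeBounds σ T ρ θ u η₁ F hE hσ hη₁ hF hZF t ht hg12
  -- ECT at accuracy one: the third-moment level
  obtain ⟨M₃, N₀E, HEN⟩ := HE σ hσ hσE' T ρ θ u hE Φ htie t htI 1 one_pos
  -- the Gronwall rate
  refine ⟨5 / β, by positivity, fun ε hε => ?_⟩
  set ε' : ℝ := min ε 1 with hε'
  have hε'0 : 0 < ε' := lt_min hε one_pos
  have hε'1 : ε' ≤ 1 := min_le_right _ _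
  have hε'ε : ε' ≤ ε := min_le_left _ _
  set ε₁ : ℝ := β * ε' / 10 with hε₁
  have hε₁0 : 0 < ε₁ := by positivity
  set ε₃ : ℝ := ε' / (40 * (Cfz + 1)) with hε₃
  have hε₃0 : 0 < ε₃ := by positivity
  -- the window parameter `τ`
  obtain ⟨τK, hτK, HKτ⟩ := HKβ (-β) hβK ε₁ hε₁0
  obtain ⟨τC, hτC, HCτ⟩ := HCβ (-β) hβC (ε₁ / 4) (by positivity)
  obtain ⟨τQ, hτQ, HQτ⟩ := HQK G CG' hCG'0 hGc hCG'b hGagree (ε' / 10) (by positivity)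
  obtain ⟨τT, hτT, HTτ⟩ := HTV V (le_max_right _ _) ε₃ hε₃0
  set τ : ℝ := max (max τK τC) (max τQ τT) with hτ_def
  have hτ0 : 0 < τ := hτK.trans_le ((le_max_left _ _).trans (le_max_left _ _))
  obtain ⟨NK, HKN⟩ := HKτ τ ((le_max_left _ _).trans (le_max_left _ _))
  obtain ⟨NC, HCN⟩ := HCτ τ ((le_max_right _ _).trans (le_max_left _ _))
  obtain ⟨NQ, HQN⟩ := HQτ τ ((le_max_left _ _).trans (le_max_right _ _))
  obtain ⟨NT, HTN⟩ := HTτ τ ((le_max_right _ _).trans (le_max_right _ _))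
  -- `N` large enough for the freeze errors
  obtain ⟨Nsm, Hsm⟩ := exists_nat_mul_rpow_le (A := Cfz * τ * (40 * (2 * (max M₃ 0) ^ 3 + 6 + V))) hε'0
  refine ⟨τ, hτ0, max (max (max NK NC) (max NQ NT)) (max N₀E Nsm), fun N hN s hs0 hsw => ?_⟩
  simp only [max_le_iff] at hN
  obtain ⟨⟨⟨hNK, hNC⟩, hNQ, hNT⟩, hNE, hNsm⟩ := hN
  -- the window
  set w : ℝ := τ * ((N : ℝ) + 1) ^ (-(1 / 3 : ℝ)) with hw_def
  have hw0 : 0 < w := mul_pos hτ0 (Real.rpow_pos_of_pos (by positivity) _)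
  have hsw' : s ≤ s + w := le_add_of_nonneg_right hw0.le
  have hsI : s ∈ Icc 0 t := ⟨hs0, hsw'.trans hsw⟩
  have hsT : s ∈ Ico 0 T := hIt hsI
  have hswT : s + w < T := hsw.trans_lt ht.2
  have hρsc : Continuous (ρ s) := hρc s hsT
  have hρs0 : ∀ x, 0 < ρ s x := hE.density_pos s hsT
  -- C0: the one-window balance (identity + integrability)
  obtain ⟨hStrI, hColI, hbal⟩ := ClampedCurrentsDockWindowBalance.stub_windowBalance σ T N (Φ N) a₀ θ₀ u₀
    (fun s x => ρ s x * Rf (σ ^ 3 * ρ s x)) θ u hσ hσ2 ha hθ hu ha0 hθ0 hasm' hE.smooth_temperature hE.smooth_velocity hapos'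
    hE.temperature_pos s w hs0 hw0.le hswT
  -- KC1 at `(N, s)`
  have hKs := HKN N hNK s hsI
  -- LC1 at `(N, s)`: read at the solution's fields and at `ρ₀ = ρ_s` (activity inversion)
  have hcls : cl s = s := hcl_id s hsI
  have hpackA : σ ^ 3 * (⨆ x, ρ s x) ≤ min (r / (2 * (2 * (2 * Real.exp 1 + 1)))) (1 / (64 * Real.exp 1 * v₁)) := by
    have hbdd : BddAbove (Set.range (ρ s)) := (isCompact_range hρsc).bddAbove
    obtain ⟨xM, -, hxM⟩ := isCompact_univ.exists_isMaxOn univ_nonempty hρsc.continuousOn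
    have hsup : (⨆ x, ρ s x) = ρ s xM :=
      le_antisymm (ciSup_le fun x => (isMaxOn_iff.mp hxM) x (mem_univ x)) (le_ciSup hbdd xM)
    rw [hsup, mul_comm]
    exact ((hguard s hsT xM).trans_le hηwA).le
  have key : ∀ (f : T3 → ℝ) (hf : Continuous f) (hf0 : ∀ x, 0 < f x), f = (fun x => ρ s x * Rf (σ ^ 3 * ρ s x)) →
      rhoLim (profileOf f hf hf0) σ = ρ s := by
    rintro f hf hf0 rfl
    obtain ⟨_, _, -, -, h⟩ := EntropyClockDock.activity_of_density hr hsol hbd hcont huniq hσ hσ2 hρsc hρs0 (hmass s hsT) hpackA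
    exact h
  have hρ₀ : rhoLim (profileOf (ac s) (hacc s) (hac0 s)) σ = ρ s :=
    key (ac s) (hacc s) (hac0 s) (by simp only [hac_def, hcls])
  obtain ⟨hCm', hCe'⟩ := HCN N hNC s hsI
  have hCm := fun k : Fin 3 => hCm' k
  have hCe := hCe'
  simp only [hρ₀] at hCm hCe
  simp only [hac_def, hθc_def, huc_def, hcls] at hCm hCe
  -- CC3 at `(N, s)`, QC-b at `(N, s)`, ECT on the window
  have hTs := HTN N hNT s hsI
  have hQs := HQN N hNQ s hs0 hsw
  have HEN' : ∀ r' ∈ Icc s (s + w), ∫⁻ z, ENNReal.ofReal (((N : ℝ) + 1)⁻¹ * ∑ i : Fin (N + 1),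
      Set.indicator {v : V3 | M₃ < ‖v‖} (fun v => ‖v‖ ^ 3) (((Φ N).flow r' z i).2)) ∂(localGibbsLaw σ a₀ u₀ θ₀ N (Φ N)) ≤
      ENNReal.ofReal 1 := fun r' hr' => HEN N hNE r' ⟨hs0.trans hr'.1, hr'.2.trans hsw⟩
  -- Lipschitz constants of the test functions at `s`, continuity and bound of the cut-off profile at `s`
  have hLipm : ∀ (k : Fin 3) (x y : T3), |u s x k / θ s x - u s y k / θ s y| ≤ Cfz * Torus.euclidDist x y :=
    fun k x y => ((HFZ s hsI s hsI x 0).2.2.2.2.1) k y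
  have hLipe : ∀ x y : T3, |(-(θ s x)⁻¹) - (-(θ s y)⁻¹)| ≤ Cfz * Torus.euclidDist x y :=
    fun x y => ((HFZ s hsI s hsI x 0).2.2.2.2.2) y
  have hGs : Continuous (G s) :=
    hGc.comp_continuous (continuous_const.prodMk continuous_id) fun y => ⟨hsI, mem_univ _⟩
  have hCGs : ∀ y : T3 × ℝ, 0 ≤ y.2 → |G s y| ≤ CG' := fun y hy => hCG'b s hsI y hy
  have hsmall : Cfz * w * (40 * (2 * (max M₃ 0) ^ 3 + 6 + V)) ≤ ε' := by
    have := Hsm N hNsm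
    calc Cfz * w * (40 * (2 * (max M₃ 0) ^ 3 + 6 + V))
        = Cfz * τ * (40 * (2 * (max M₃ 0) ^ 3 + 6 + V)) * ((N : ℝ) + 1) ^ (-(1 / 3 : ℝ)) := by rw [hw_def]; ring
      _ ≤ ε' := this
  -- THE ONE-WINDOW ESTIMATE (the sibling's `window_estimate`; all implicit arguments given explicitly — the unifier must not
  -- solve metavariables through the window functionals)
  have hWE := @ClampedCurrentsDockHeart.window_estimate σ T η₁ τ t s w V Cfz Cfz CG' β ε' ε₁ ε₃ M₃ N (Φ N) ρ θ u F Rf G a₀ θ₀ u₀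
    ha hθ hu ha0 hθ0 hE hσ hσ2 hη₁ hF hZF hRfF hg1 hasm' hapos' ht hs0 hw0 hsw hτ0 hw_def hV0 hCfz0 hCfz0 hLipm hLipe hGs hCGs HFZ
    hβ0 hε'0 hε'1 hε₁ hε₃ hsmall hKs hCm hCe hTs hQs HEN' hStrI hColI
  -- the a-priori bound: the running supremum is a supremum
  obtain ⟨B, hB⟩ := EntropyClockDock.ledgerAprioriBound r Rf hr hbd hcont a₀ θ₀ u₀ ha hθ hu ha0 hθ0 σ hσ hσ2 T ρ θ u hE t ht hgr
    N (Φ N)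
  have hswI : Icc 0 (s + w) ⊆ Icc 0 t := Icc_subset_Icc_right hsw
  have hbdd : BddAbove ((fun s' => (klDiv ((Φ N).lawAt (localGibbsLaw σ a₀ u₀ θ₀ N (Φ N)) s')
      (localGibbsLaw σ (fun x => ρ s' x * Rf (σ ^ 3 * ρ s' x)) (u s') (θ s') N (Φ N))).toReal) '' Icc 0 (s + w)) := by
    refine ⟨max B 0, ?_⟩
    rintro _ ⟨s', hs', rfl⟩
    exact ENNReal.toReal_le_of_le_ofReal (le_max_right _ _)
      ((hB s' (hswI hs')).trans (ENNReal.ofReal_le_ofReal (le_max_left _ _)))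
  have hHs_le : (klDiv ((Φ N).lawAt (localGibbsLaw σ a₀ u₀ θ₀ N (Φ N)) s)
      (localGibbsLaw σ (fun x => ρ s x * Rf (σ ^ 3 * ρ s x)) (u s) (θ s) N (Φ N))).toReal ≤
      sSup ((fun s' => (klDiv ((Φ N).lawAt (localGibbsLaw σ a₀ u₀ θ₀ N (Φ N)) s')
        (localGibbsLaw σ (fun x => ρ s' x * Rf (σ ^ 3 * ρ s' x)) (u s') (θ s') N (Φ N))).toReal) '' Icc 0 (s + w)) :=
    le_csSup hbdd ⟨s, ⟨hs0, hsw'⟩, rfl⟩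
  have hK0 : 0 ≤ 5 / β * w := by positivity
  have h1 := mul_le_mul_of_nonneg_left hHs_le hK0
  have hwN : 0 ≤ w * ((N : ℝ) + 1) := by positivity
  have h2 : w * ((N : ℝ) + 1) * ε' ≤ w * ((N : ℝ) + 1) * ε := mul_le_mul_of_nonneg_left hε'ε hwN
  linarith [hbal, hWE, h1, h2]

/-- **`WindowClauseInBand` from `LineInputs` alone** (lead c7): the four pathwise antecedents of `WindowClause` are landed (S2/S8/S4/S10). [folklore] -/
theorem windowClauseInBand_of_lineInputs (hI : HydroLimitInBandOfHeart.LineInputs) : WindowClauseInBand :=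
  stub_windowClause ClampedCurrentsDockPathwise.stub_pathwise ClampedCurrentsDockCancellation.stub_cancellation ClampedCurrentsDockEos.stub_eos
    ClampedCurrentsDockClampRemainder.stub_transferClampRemainder hI.1 hI.2.1 hI.2.2.1 hI.2.2.2.1 hI.2.2.2.2.1 hI.2.2.2.2.2

end Summit.AtomisticToContinuum.HydrodynamicLimit.Theorems.HydroLimitInBandHeart

end
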